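import Mathlib
import Summits.Ventures.PercRepro.TriangleCapStarFamilyClasses
import Summits.Ventures.PercRepro.TriangleCapAddEdges
import Summits.Ventures.PercRepro.TriangleCapDeepThreeWitness
import Summits.Ventures.PercRepro.TriangleCapSubBandMember

/-!
# PercRepro — THE STAR FAMILY: THE GRAPH, ITS TRIANGLE-FREENESS, EDGES AND THE DEGREE OF `w` (p3, gen 56; part 317)

On `n = ℓ + 1 + (s − t)` vertices, `t = Rc + a (D − 1) + Q D + a`: the bipartite part `H0SF` is the pair witness
of part 245 with the ends of parts 315–316 and the star of `s − t` leaves at `w = 0` (`s − a` edges); the inside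
edges `SSF` join the centre `a + Q + 1` to every special `1, …, a`; the graph of the band is `HSF = addEdges H0SF SSF`.
It is triangle-free (`cliqueFree_HSF`: the inside edges form a star; the centre's rows `ℓ + 1, …, ℓ + Rc` and the
specials' rows `ℓ + Rc + 1, …` are disjoint; two left vertices are never adjacent in `H0SF`), has `s` edges
(`card_edges_HSF`) and `w` of degree `s − t` (`deg_HSF_zero`); its off-degrees `offSF` are computed in part 317b
(TriangleCapStarFamilyOffDeg).  Axioms: standard.
-/

namespace PercRepro

namespace TriangleCap

namespace C047

open Finset

/-- Membership of `fin' v` in the pair `s(fin' p, fin' q)` (`v, p, q < n`). -/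
theorem mem_pair_iff' (n : ℕ) (hn : 0 < n) (v p q : ℕ) (hv : v < n) (hp : p < n) (hq : q < n) :
    fin' n hn v ∈ s(fin' n hn p, fin' n hn q) ↔ v = p ∨ v = q := by
  rw [Sym2.mem_iff, Fin.ext_iff, Fin.ext_iff, fin'_val n hn v hv, fin'_val n hn p hp, fin'_val n hn q hq]

/-- `fin' p ≠ fin' q` for `p ≠ q < n`. -/
theorem fin'_ne' (n : ℕ) (hn : 0 < n) (p q : ℕ) (hp : p < n) (hq : q < n) (hpq : p ≠ q) :
    fin' n hn p ≠ fin' n hn q := by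
  intro h
  have := congrArg Fin.val h
  rw [fin'_val n hn p hp, fin'_val n hn q hq] at this
  exact hpq this

/-- The number of vertices of the band: `ℓ + 1 + (s − t)`. -/
abbrev nSF (s ℓ t : ℕ) : ℕ := ℓ + 1 + (s - t)

/-- `0 < nSF`. -/
theorem nSF_pos (s ℓ t : ℕ) : 0 < nSF s ℓ t := by
  unfold nSF
  omega

/-- The bipartite part: the pair witness with the ends of the star family and `s − a` edges. -/
abbrev H0SF (s ℓ t D a Rc short E Q : ℕ) : SimpleGraph (Fin (nSF s ℓ t)) :=
  missingGraph (genWitness (nSF s ℓ t) (ℓ + 1) (s - a) (Rc + a * (D - 1) + Q * D) (nSF_pos s ℓ t)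
    (lfSF D a Rc Q) (rfSF ℓ D a Rc short E)) (leftPart (nSF s ℓ t) (ℓ + 1))

/-- The inside edges: the centre `a + Q + 1` joined to every special `1 + c`, `c < a`. -/
abbrev SSF (s ℓ t a Q : ℕ) : Finset (Sym2 (Fin (nSF s ℓ t))) :=
  (range a).image (fun c => s(fin' (nSF s ℓ t) (nSF_pos s ℓ t) (a + Q + 1), fin' (nSF s ℓ t) (nSF_pos s ℓ t) (1 + c)))

/-- **THE GRAPH OF THE STAR FAMILY:** the bipartite part plus the inside edges. -/
abbrev HSF (s ℓ t D a Rc short E Q : ℕ) : SimpleGraph (Fin (nSF s ℓ t)) :=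
  addEdges (H0SF s ℓ t D a Rc short E Q) (SSF s ℓ t a Q)

/-- The off-degrees of the star family at `w = 0`, as a function of the vertex number. -/
def offSF (ℓ D a Rc short E Q v : ℕ) : ℕ :=
  if v = 0 then 0
  else if v ≤ a then D
  else if v ≤ a + Q then D
  else if v = a + Q + 1 then Rc + a
  else if v ≤ ℓ then 0
  else if v < ℓ + 1 + Rc then 1 + kSF D a Rc short (v - (ℓ + 1))
  else if v < ℓ + 1 + Rc + (D - 1) then a + kSF D a Rc short (v - (ℓ + 1))
  else if v < ℓ + 1 + (Rc + (D - 1) + E) then D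
  else 0

/-- Membership in the inside edges. -/
theorem mem_SSF (s ℓ t a Q : ℕ) (e : Sym2 (Fin (nSF s ℓ t))) :
    e ∈ SSF s ℓ t a Q ↔ ∃ c, c < a ∧
      s(fin' (nSF s ℓ t) (nSF_pos s ℓ t) (a + Q + 1), fin' (nSF s ℓ t) (nSF_pos s ℓ t) (1 + c)) = e := by
  unfold SSF
  rw [mem_image]
  simp only [mem_range]

/-- The ends of an inside edge: the centre and a special, hence left vertices `1 ≤ x ≤ a + Q + 1`. -/
theorem SSF_ends (s ℓ t a Q : ℕ) (hℓ : a + Q + 1 ≤ ℓ) (e : Sym2 (Fin (nSF s ℓ t))) (he : e ∈ SSF s ℓ t a Q)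
    (x : Fin (nSF s ℓ t)) (hx : x ∈ e) : (x.val = a + Q + 1 ∨ (1 ≤ x.val ∧ x.val ≤ a)) := by
  obtain ⟨c, hc, rfl⟩ := (mem_SSF s ℓ t a Q e).mp he
  have hxv : x = fin' (nSF s ℓ t) (nSF_pos s ℓ t) x.val := Fin.ext (by rw [fin'_val _ _ x.val x.isLt])
  rw [hxv, mem_pair_iff' (nSF s ℓ t) (nSF_pos s ℓ t) x.val (a + Q + 1) (1 + c) x.isLt (by unfold nSF; omega)
    (by unfold nSF; omega)] at hx
  omega

/-- Every inside edge contains the centre. -/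
theorem SSF_centre (s ℓ t a Q : ℕ) (e : Sym2 (Fin (nSF s ℓ t))) (he : e ∈ SSF s ℓ t a Q) :
    fin' (nSF s ℓ t) (nSF_pos s ℓ t) (a + Q + 1) ∈ e := by
  obtain ⟨c, -, rfl⟩ := (mem_SSF s ℓ t a Q e).mp he
  exact Sym2.mem_mk_left _ _

/-- No inside edge is diagonal. -/
theorem SSF_nondiag (s ℓ t a Q : ℕ) (hℓ : a + Q + 1 ≤ ℓ) : ∀ e ∈ SSF s ℓ t a Q, ¬ e.IsDiag := by
  intro e he
  obtain ⟨c, hc, rfl⟩ := (mem_SSF s ℓ t a Q e).mp he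
  rw [Sym2.mk_isDiag_iff]
  exact fin'_ne' _ _ _ _ (by unfold nSF; omega) (by unfold nSF; omega) (by omega)

/-- `0` lies in no inside edge. -/
theorem SSF_zero (s ℓ t a Q : ℕ) (hℓ : a + Q + 1 ≤ ℓ) :
    ∀ e ∈ SSF s ℓ t a Q, fin' (nSF s ℓ t) (nSF_pos s ℓ t) 0 ∉ e := by
  intro e he h
  have := SSF_ends s ℓ t a Q hℓ e he _ h
  rw [fin'_val _ _ 0 (nSF_pos s ℓ t)] at this
  omega

/-- Two vertices of the left part are never adjacent in the bipartite part. -/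
theorem not_adj_H0SF_left (s ℓ t D a Rc short E Q : ℕ) (x y : Fin (nSF s ℓ t)) (hx : x.val < ℓ + 1)
    (hy : y.val < ℓ + 1) : ¬ (H0SF s ℓ t D a Rc short E Q).Adj x y := by
  intro h
  have hb := bipSub_missingGraph (genWitness (nSF s ℓ t) (ℓ + 1) (s - a) (Rc + a * (D - 1) + Q * D)
    (nSF_pos s ℓ t) (lfSF D a Rc Q) (rfSF ℓ D a Rc short E)) (leftPart (nSF s ℓ t) (ℓ + 1)) x y h
  simp only [leftPart, mem_filter, mem_univ, true_and] at hb
  exact (hb.mp hx) hy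

/-- A non-zero left vertex adjacent to a right vertex in the bipartite part is the end of a pair. -/
theorem adj_H0SF_pair (s ℓ t D a Rc short E Q : ℕ) (ha : 1 ≤ a) (hRc : 1 ≤ Rc) (hshort : short + 1 ≤ D)
    (hQ : 1 ≤ Q) (hQ1 : D ≤ Q + 1) (hQE : 1 ≤ E → D ≤ Q)
    (hinc : Rc * (D - 1) + (D - 1) * (D - a) + E * D = Q * D + short) (hℓ : a + Q + 1 ≤ ℓ)
    (hN : Rc + (D - 1) + E ≤ s - t) (x y : Fin (nSF s ℓ t)) (hx1 : 1 ≤ x.val) (hx : x.val < ℓ + 1)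
    (hy : ℓ + 1 ≤ y.val) (h : (H0SF s ℓ t D a Rc short E Q).Adj x y) :
    ∃ i, i < Rc + a * (D - 1) + Q * D ∧ lfSF D a Rc Q i = x.val ∧ rfSF ℓ D a Rc short E i = y.val := by
  have hg := goodEnds_SF (nSF s ℓ t) ℓ D a Rc short E Q ha hRc hshort hQ hQ1 hQE hinc hℓ (by unfold nSF; omega)
  rw [missingGraph_genWitness_adj (nSF s ℓ t) (ℓ + 1) (s - a) (Rc + a * (D - 1) + Q * D) (nSF_pos s ℓ t)
    (lfSF D a Rc Q) (rfSF ℓ D a Rc short E) x y hx hy] at h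
  rcases h with ⟨h0, -⟩ | h
  · omega
  · rw [mem_genPairs] at h
    obtain ⟨i, hi, he⟩ := h
    unfold genPair at he
    rw [Sym2.eq_iff] at he
    have hl := hg.1 i hi
    have hr := hg.2.1 i hi
    rcases he with ⟨hx', hy'⟩ | ⟨hx', hy'⟩
    · refine ⟨i, hi, ?_, ?_⟩
      · rw [← hx', fin'_val _ _ _ (by unfold nSF; omega)]
      · rw [← hy', fin'_val _ _ _ hr.2]
    · exfalso
      have := congrArg Fin.val hy'
      rw [fin'_val _ _ _ hr.2] at this
      omega

/-- No inside edge is an edge of the bipartite part. -/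
theorem SSF_new (s ℓ t D a Rc short E Q : ℕ) (hℓ : a + Q + 1 ≤ ℓ) :
    ∀ u v, s(u, v) ∈ SSF s ℓ t a Q → ¬ (H0SF s ℓ t D a Rc short E Q).Adj u v := by
  intro u v h
  have hu := SSF_ends s ℓ t a Q hℓ _ h u (Sym2.mem_mk_left u v)
  have hv := SSF_ends s ℓ t a Q hℓ _ h v (Sym2.mem_mk_right u v)
  exact not_adj_H0SF_left s ℓ t D a Rc short E Q u v (by omega) (by omega)

/-- The inside edges form a star, hence a triangle-free graph. -/
theorem SSF_triangle_free (s ℓ t a Q : ℕ) (hℓ : a + Q + 1 ≤ ℓ) :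
    ∀ x y z, s(x, y) ∈ SSF s ℓ t a Q → s(y, z) ∈ SSF s ℓ t a Q → s(x, z) ∈ SSF s ℓ t a Q → False := by
  intro x y z h1 h2 h3
  have hxy : x.val ≠ y.val := fun h => SSF_nondiag s ℓ t a Q hℓ _ h1 (by
    rw [Sym2.mk_isDiag_iff]
    exact Fin.ext h)
  have hyz : y.val ≠ z.val := fun h => SSF_nondiag s ℓ t a Q hℓ _ h2 (by
    rw [Sym2.mk_isDiag_iff]
    exact Fin.ext h)
  have hxz : x.val ≠ z.val := fun h => SSF_nondiag s ℓ t a Q hℓ _ h3 (by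
    rw [Sym2.mk_isDiag_iff]
    exact Fin.ext h)
  have c1 := SSF_centre s ℓ t a Q _ h1
  have c2 := SSF_centre s ℓ t a Q _ h2
  have c3 := SSF_centre s ℓ t a Q _ h3
  rw [Sym2.mem_iff] at c1 c2 c3
  have hC : a + Q + 1 < nSF s ℓ t := by
    unfold nSF
    omega
  have e1 : ∀ u : Fin (nSF s ℓ t), fin' (nSF s ℓ t) (nSF_pos s ℓ t) (a + Q + 1) = u → u.val = a + Q + 1 := by
    intro u hu
    rw [← hu, fin'_val _ _ _ hC]
  rcases c1 with c1 | c1 <;> rcases c2 with c2 | c2 <;> rcases c3 with c3 | c3 <;>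
    simp only [e1 _ c1, e1 _ c2, e1 _ c3] at hxy hyz hxz <;> omega

/-- No inside edge has a common neighbour in the bipartite part: the centre's rows are the centre rows, a
special's rows are outer rows. -/
theorem SSF_no_common (s ℓ t D a Rc short E Q : ℕ) (ha : 1 ≤ a) (hRc : 1 ≤ Rc) (hshort : short + 1 ≤ D)
    (hQ : 1 ≤ Q) (hQ1 : D ≤ Q + 1) (hQE : 1 ≤ E → D ≤ Q)
    (hinc : Rc * (D - 1) + (D - 1) * (D - a) + E * D = Q * D + short) (hℓ : a + Q + 1 ≤ ℓ)
    (hN : Rc + (D - 1) + E ≤ s - t) :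
    ∀ x y z, s(x, y) ∈ SSF s ℓ t a Q → (H0SF s ℓ t D a Rc short E Q).Adj x z →
      (H0SF s ℓ t D a Rc short E Q).Adj y z → False := by
  intro x y z hS hxz hyz
  have hx := SSF_ends s ℓ t a Q hℓ _ hS x (Sym2.mem_mk_left x y)
  have hy := SSF_ends s ℓ t a Q hℓ _ hS y (Sym2.mem_mk_right x y)
  rcases Nat.lt_or_ge z.val (ℓ + 1) with hz | hz
  · exact not_adj_H0SF_left s ℓ t D a Rc short E Q x z (by omega) hz hxz
  obtain ⟨i, hi, hli, hri⟩ := adj_H0SF_pair s ℓ t D a Rc short E Q ha hRc hshort hQ hQ1 hQE hinc hℓ hN x z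
    (by omega) (by omega) hz hxz
  obtain ⟨i', hi', hli', hri'⟩ := adj_H0SF_pair s ℓ t D a Rc short E Q ha hRc hshort hQ hQ1 hQE hinc hℓ hN y z
    (by omega) (by omega) hz hyz
  have hne : x.val ≠ y.val := fun h => SSF_nondiag s ℓ t a Q hℓ _ hS (by
    rw [Sym2.mk_isDiag_iff]
    exact Fin.ext h)
  have hC : a + Q + 1 < nSF s ℓ t := by
    unfold nSF
    omega
  have hc := SSF_centre s ℓ t a Q _ hS
  rw [Sym2.mem_iff] at hc
  -- one end is the centre, the other a special
  rcases hc with hc | hc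
  · have hx' : x.val = a + Q + 1 := by rw [← hc, fin'_val _ _ _ hC]
    have hy' : 1 ≤ y.val ∧ y.val ≤ a := by omega
    have hiC : i < Rc := (lfSF_eq_centre_iff D a Rc Q i ha hQ).mp (by omega)
    have hiS := (lfSF_le_iff D a Rc Q i' ha hQ).mp (by omega)
    have h1 := rfSF_of_centre ℓ D a Rc short E i hiC
    have h2 := rfSF_of_special ℓ D a Rc short E i' hiS.1 hiS.2
    omega
  · have hy' : y.val = a + Q + 1 := by rw [← hc, fin'_val _ _ _ hC]
    have hx' : 1 ≤ x.val ∧ x.val ≤ a := by omega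
    have hiC : i' < Rc := (lfSF_eq_centre_iff D a Rc Q i' ha hQ).mp (by omega)
    have hiS := (lfSF_le_iff D a Rc Q i ha hQ).mp (by omega)
    have h1 := rfSF_of_centre ℓ D a Rc short E i' hiC
    have h2 := rfSF_of_special ℓ D a Rc short E i hiS.1 hiS.2
    omega

/-- No two inside edges at a vertex are closed by an edge of the bipartite part (their ends are left vertices). -/
theorem SSF_no_mixed (s ℓ t D a Rc short E Q : ℕ) (hℓ : a + Q + 1 ≤ ℓ) :
    ∀ x y z, s(x, y) ∈ SSF s ℓ t a Q → s(y, z) ∈ SSF s ℓ t a Q →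
      (H0SF s ℓ t D a Rc short E Q).Adj x z → False := by
  intro x y z h1 h2 hxz
  have hx := SSF_ends s ℓ t a Q hℓ _ h1 x (Sym2.mem_mk_left x y)
  have hz := SSF_ends s ℓ t a Q hℓ _ h2 z (Sym2.mem_mk_right y z)
  exact not_adj_H0SF_left s ℓ t D a Rc short E Q x z (by omega) (by omega) hxz

/-- **THE STAR FAMILY IS TRIANGLE-FREE.** -/
theorem cliqueFree_HSF (s ℓ t D a Rc short E Q : ℕ) (ha : 1 ≤ a) (hRc : 1 ≤ Rc) (hshort : short + 1 ≤ D)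
    (hQ : 1 ≤ Q) (hQ1 : D ≤ Q + 1) (hQE : 1 ≤ E → D ≤ Q)
    (hinc : Rc * (D - 1) + (D - 1) * (D - a) + E * D = Q * D + short) (hℓ : a + Q + 1 ≤ ℓ)
    (hN : Rc + (D - 1) + E ≤ s - t) : (HSF s ℓ t D a Rc short E Q).CliqueFree 3 :=
  cliqueFree_addEdges _ _ (cliqueFree_of_bipSub _ _ (bipSub_missingGraph _ _)) (SSF_triangle_free s ℓ t a Q hℓ)
    (SSF_no_common s ℓ t D a Rc short E Q ha hRc hshort hQ hQ1 hQE hinc hℓ hN) (SSF_no_mixed s ℓ t D a Rc short E Q hℓ)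

/-- The inside edges are `a` in number. -/
theorem card_SSF (s ℓ t a Q : ℕ) (hℓ : a + Q + 1 ≤ ℓ) : (SSF s ℓ t a Q).card = a := by
  unfold SSF
  rw [card_image_of_injOn, card_range]
  intro c hc c' hc' h
  rw [mem_coe, mem_range] at hc hc'
  rw [Sym2.eq_iff] at h
  rcases h with ⟨-, h⟩ | ⟨h, -⟩
  · have := congrArg Fin.val h
    rw [fin'_val _ _ _ (by unfold nSF; omega), fin'_val _ _ _ (by unfold nSF; omega)] at this
    omega
  · have := congrArg Fin.val h
    rw [fin'_val _ _ _ (by unfold nSF; omega), fin'_val _ _ _ (by unfold nSF; omega)] at this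
    omega

/-- **THE EDGE COUNT:** `s`. -/
theorem card_edges_HSF (s ℓ t D a Rc short E Q : ℕ) (ht : t = Rc + a * (D - 1) + Q * D + a) (ha : 1 ≤ a)
    (hRc : 1 ≤ Rc) (hshort : short + 1 ≤ D) (hQ : 1 ≤ Q) (hQ1 : D ≤ Q + 1) (hQE : 1 ≤ E → D ≤ Q)
    (hinc : Rc * (D - 1) + (D - 1) * (D - a) + E * D = Q * D + short) (hℓ : a + Q + 1 ≤ ℓ)
    (hN : Rc + (D - 1) + E ≤ s - t) (hs : 2 * t ≤ s) : (HSF s ℓ t D a Rc short E Q).edgeFinset.card = s := by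
  have hg := goodEnds_SF (nSF s ℓ t) ℓ D a Rc short E Q ha hRc hshort hQ hQ1 hQE hinc hℓ (by unfold nSF; omega)
  rw [card_edgeFinset_addEdges _ _ (SSF_nondiag s ℓ t a Q hℓ) (SSF_new s ℓ t D a Rc short E Q hℓ),
    card_edges_missingGraph_genWitness (nSF s ℓ t) (ℓ + 1) (s - a) (Rc + a * (D - 1) + Q * D) (nSF_pos s ℓ t)
      (lfSF D a Rc Q) (rfSF ℓ D a Rc short E) hg (by omega) (by omega) (by unfold nSF; omega),
    card_SSF s ℓ t a Q hℓ]
  omega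

/-- **THE DEGREE OF `w = 0`:** `s − t`. -/
theorem deg_HSF_zero (s ℓ t D a Rc short E Q : ℕ) (ht : t = Rc + a * (D - 1) + Q * D + a) (ha : 1 ≤ a)
    (hRc : 1 ≤ Rc) (hshort : short + 1 ≤ D) (hQ : 1 ≤ Q) (hQ1 : D ≤ Q + 1) (hQE : 1 ≤ E → D ≤ Q)
    (hinc : Rc * (D - 1) + (D - 1) * (D - a) + E * D = Q * D + short) (hℓ : a + Q + 1 ≤ ℓ)
    (hN : Rc + (D - 1) + E ≤ s - t) (hs : 2 * t ≤ s) :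
    deg (HSF s ℓ t D a Rc short E Q) (fin' (nSF s ℓ t) (nSF_pos s ℓ t) 0) = s - t := by
  have hg := goodEnds_SF (nSF s ℓ t) ℓ D a Rc short E Q ha hRc hshort hQ hQ1 hQE hinc hℓ (by unfold nSF; omega)
  rw [deg_addEdges_of_notMem _ _ _ (SSF_zero s ℓ t a Q hℓ),
    deg_missingGraph_genWitness_zero (nSF s ℓ t) (ℓ + 1) (s - a) (Rc + a * (D - 1) + Q * D) (nSF_pos s ℓ t)
      (lfSF D a Rc Q) (rfSF ℓ D a Rc short E) hg (by omega) (by unfold nSF; omega)]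
  omega

end C047

end TriangleCap

end PercRepro
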